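import Summits.QuantumFields.YangMills.Theorems.BalabanUVNodesK1EndExactRowsStrict
import Summits.QuantumFields.YangMills.Theorems.BalabanUVNodesK1R8RowsDefs

/-!
# THE RESTRICTION TO TOP RUNS IS FREE: K1⁹'s row (iv) and the END-exact dial's (T) differ by ONE QUANTIFIER SWAP
# (port with attribution of ym-nodeO P3 n°101 `TopRunsInRowsCurrency-P3g56.lean` §1–§3 core, def-free)

Cell `pub-ymgap`, seat `pub-ymgap-dag-n13-w4` (g8), N13 [B16] width seat 4∕4; `--kind proof --supports stmt-QuantumFields-27364 --as helper` (K1⁹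
`…Theses.BalabanUVNodes.StabilityBRunRowsAtRecordR13SepCoPHV`, crux r3 DECIDING, route rev 29, skeleton v10).  FILE 7 of this lineage's END-EXACTNESS census.  PORT WITH ATTRIBUTION of
the YM-NODE-O IDEATION cell's seat P3 («weaken the target») evidence n°101 `run/shared/lean/pub/ym-nodeO-ideate/memos/lines/TopRunsInRowsCurrency-P3g56.lean` (sha256 5a37335addab6d51…,
556 l., g56; evidence row 52 on stmt-QuantumFields-27364; bus `pub-ymgap/INBOX.md` l.39842 addressed «dag-n13-w4 g8») — its NEW core §3 (the running-maximum argument) with the §1∕§2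
bookkeeping it needs; the shapes `RunwisePSFloor` ∕ `TopRunPSFloor` ∕ `TopRunsAt` are written INLINE (theorems only, 0 `def`); P3's names kept decl by decl.

THE POINT.  My FILE 2 (p626836 `…K1EndExactRowsStrict.topRunThreshold_iff_topRunPSFloor`, itself a port of n°95 :993) named TWO differences between the dial's threshold letter (T) and
K1⁹'s pressed row (iv): «(PS) RESTRICTED to top runs» and «DE-UNIFORMISED in the level».  P3 n°101 shows THE FIRST COSTS NOTHING: for a FIXED constant `M`, the run-wise partial-sum floor
on ALL tails of ALL in-`]0, γ₀]` runs (row (iv) at `γ₀`) is EQUIVALENT to the floor on TOP-ANCHORED tails only, asked at EVERY level `γ ≤ γ₀` — because the running maximum `g_{k₀}` of an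
in-window run re-anchors every tail at the top of the smaller window `]0, g_{k₀}]`, and `g_k⁻² ≥ g_{k₀}⁻²`.  Hence, over ONE proposition `TopFloor(M, γ)`:
  ROW (iv) at `γ₀`  ⟺  `∃ M, ∀ γ ∈ ]0, γ₀], TopFloor(M, γ)`        (this file, ★★ `runwisePSFloor_iff_topRunPSFloor_allLevels`),
  DIAL's (T) on `]0, γ₀]`  ⟺  `∀ γ ∈ ]0, γ₀], ∃ M ≥ 0, TopFloor(M, γ)`  (FILE 2's iff, level by level)
— the rows' surplus over the END-exact dial is EXACTLY ONE QUANTIFIER SWAP (`rows_vs_dial_one_quantifier_swap`); it is STRICT (n°100 ∕ my FILES 5–6 `…K1EndExactSawtooth*`: (T) at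
every level with floors `M(γ) = 3∕γ²` unbounded, no uniform `M`) and VOID under the sign datum `0 ≤ β` (`M = 0`).

WHAT THIS FILE PROVES (theorems only; 0 `def`): §1 `exists_runMax` (a finite run attains its maximum), `tail_sum_eq` (telescoped (0.20) on a tail, `FlowStep.inv_sq_telescopeH` BY NAME);
§2 `topRunPSFloor_of_topRunsAt` ((T) with threshold `g⋆` at level `γ` ⟹ top-anchored floor `M = g⋆⁻² − γ⁻²`); §3 `topRunPSFloor_of_runwisePSFloor` (trivial direction),
★ `runwisePSFloor_of_topRunPSFloor_allLevels` (the running-maximum argument), ★★ `runwisePSFloor_iff_topRunPSFloor_allLevels`, `runwisePSFloor_of_topRuns_uniform` ((T) on `]0,γ₀]` with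
thresholds whose floor-equivalents are bounded by ONE `M` ⟹ row (iv) with that `M`), ★ `rows_vs_dial_one_quantifier_swap` (the displayed pair), and BY NAME at the record (CONDITIONAL on
K1⁹'s OPEN rows conjunct): `topFloors_uniform_of_runRowsCont13` (`K1R8RowsDefs.RunRowsCont13 F θ` ⟹ ONE `M` flooring the top-anchored tails of `β_θ` at every level `≤ γ₀`).

HONEST FRAMING.  [folklore] real analysis over the tree's carriers (`FlowStep.RGEqH`, `Step.InInterval`); implications between HYPOTHESIS SHAPES; nothing of Bałaban asserted; NOTHING
about `Node00.betaOfRecord₁₃` inhabited (§4 is conditional on K1⁹'s open conjunct); no item filed ∕ re-keyed (R-30 reserve dial; HARD FREEZE №216); K1⁹ NOT closed (0∕6 stubs); N13 NOT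
discharged; counts UNMOVED (typed 28∕28 · discharged 5∕27 · A 5∕28).  One finite 𝕋⁴ programme at fixed ε; R4 = the CONDITIONAL finite-𝕋⁴ rung `BalabanLadder.UV` only — the Yang–Mills
mass gap (Clay) is NOT proved by any of this; nothing continuum ∕ ℝ⁴ ∕ OS.  No `sorry`, no `axiom`, no `def`, no `instance`, no `notation`.
Sources (locators only): [Balaban1987RG1] Commun. Math. Phys. 109 (1987) (0.20) p. 256, Thm 2 p. 259 (first sentence), (5.10) p. 293; [Balaban1988Convergent] Commun. Math. Phys. 119
(1988) (2.6) p. 255; [Balaban1989LargeFieldII] Thm 1 + (0.1) pp. 355–356 (where K1's rows are consumed).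
-/

noncomputable section

open scoped BigOperators

namespace Summit.QuantumFields.YangMills.Theorems.BalabanUVNodesK1EndExactTopRunsFree

open Literature.MathematicalPhysics.QuantumFieldTheory.Balaban1983to89
open Literature.MathematicalPhysics.QuantumFieldTheory.Balaban1983to89.FlowStep (HBeta prefixOf prefixOf_apply Box mem_box RGEqH inv_sq_telescopeH)
open Literature.MathematicalPhysics.QuantumFieldTheory.Balaban1983to89.T4Continuum (T4Family)
open Summit.QuantumFields.YangMills.Theorems.BalabanUVNodesK2NamedJetsRunRemAt (RunConstRemainder SurvCont)
open Summit.QuantumFields.YangMills.Theorems.BalabanUVNodesK1R8RowsDefs (RunRowsCont13)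
open Summit.QuantumFields.YangMills.Theorems.BalabanUVNodesK1EndExactRowsStrict (topRunThreshold_iff_topRunPSFloor)

variable {β : HBeta}

/-! ## §1 Bookkeeping: the running maximum of a finite run; telescoped tails — P3 n°101 §1 -/

/-- a finite run attains its maximum: some `k₀ ≤ n` with `g_i ≤ g_{k₀}` for all `i ≤ n`. P3 n°101 `exists_runMax`. [folklore] -/
theorem exists_runMax (gs : ℕ → ℝ) (n : ℕ) : ∃ k₀, k₀ ≤ n ∧ ∀ i, i ≤ n → gs i ≤ gs k₀ := by
  obtain ⟨k₀, hk₀, hmax⟩ := Finset.exists_max_image (Finset.range (n + 1)) gs ⟨0, by simp⟩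
  exact ⟨k₀, Nat.lt_succ_iff.mp (Finset.mem_range.mp hk₀),
    fun i hi => hmax i (Finset.mem_range.mpr (Nat.lt_succ_of_le hi))⟩

/-- telescoped (0.20) on a tail: `Σ_{j∈[k,n)} β_j = g_k⁻² − g_n⁻²` (`FlowStep.inv_sq_telescopeH` BY NAME). P3 n°101 `tail_sum_eq`. [cite: Balaban1987RG1, (0.20) p.256 (the recursion; elementary)] -/
theorem tail_sum_eq {n : ℕ} {gs : ℕ → ℝ} (h : RGEqH n β gs) {k : ℕ} (hk : k ≤ n) :
    ∑ j ∈ Finset.Ico k n, β j (prefixOf gs j) = 1 / (gs k) ^ 2 - 1 / (gs n) ^ 2 := by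
  have := inv_sq_telescopeH h hk le_rfl
  linarith

/-! ## §2 One level: a threshold floors the top-anchored tails explicitly — P3 n°101 §2 -/

/-- **(T) WITH THRESHOLD `g⋆` AT LEVEL `γ` ⟹ THE TOP-ANCHORED FLOOR WITH `M = g⋆⁻² − γ⁻²`**: along an in-`]0,γ]` solution of (0.20) touching the top at `k`, `Σ_{[k,n)} β_j = γ⁻² − g_n⁻² ≥
γ⁻² − g⋆⁻²`.  (FILE 2's `topRunThreshold_iff_topRunPSFloor` is the `∃g⋆ ⟺ ∃M` form; here the constant is displayed.) P3 n°101 `topRunPSFloor_of_topRunsAt`.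
[cite: Balaban1987RG1, (0.20) p.256, Thm 2 p.259 (first sentence); Balaban1988Convergent, (2.6) p.255 (elementary)] -/
theorem topRunPSFloor_of_topRunsAt {gstar γ : ℝ} (hg : 0 < gstar)
    (h : ∀ (n : ℕ) (gs : ℕ → ℝ), RGEqH n β gs → Step.InInterval γ n gs → ∀ k, k ≤ n → gs k = γ → gstar ≤ gs n) :
    ∀ (n : ℕ) (gs : ℕ → ℝ), RGEqH n β gs → Step.InInterval γ n gs →
      ∀ k, k ≤ n → gs k = γ → -(1 / gstar ^ 2 - 1 / γ ^ 2) ≤ ∑ j ∈ Finset.Ico k n, β j (prefixOf gs j) := by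
  intro n gs hrg hI k hk hgk
  have hle : gstar ≤ gs n := h n gs hrg hI k hk hgk
  have h1 : 1 / (gs n) ^ 2 ≤ 1 / gstar ^ 2 := one_div_le_one_div_of_le (by positivity) (pow_le_pow_left₀ hg.le hle 2)
  rw [tail_sum_eq hrg hk, hgk]
  linarith

/-! ## §3 ★★ The restriction to top runs is free: row (iv) at `γ₀` ⟺ the top-anchored floor with the SAME `M` at EVERY level `≤ γ₀` — P3 n°101 §3 -/

/-- the trivial direction: row (iv) at `γ₀` floors in particular the top-anchored tails at every level `γ ≤ γ₀` (an in-`]0,γ]` run is an in-`]0,γ₀]` run). P3 n°101 `topRunPSFloor_of_runwisePSFloor`. [folklore] -/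
theorem topRunPSFloor_of_runwisePSFloor {M γ₀ : ℝ}
    (h : ∀ (n : ℕ) (gs : ℕ → ℝ), RGEqH n β gs → Step.InInterval γ₀ n gs → ∀ k, k ≤ n → -M ≤ ∑ j ∈ Finset.Ico k n, β j (prefixOf gs j))
    {γ : ℝ} (hle : γ ≤ γ₀) :
    ∀ (n : ℕ) (gs : ℕ → ℝ), RGEqH n β gs → Step.InInterval γ n gs →
      ∀ k, k ≤ n → gs k = γ → -M ≤ ∑ j ∈ Finset.Ico k n, β j (prefixOf gs j) :=
  fun n gs hrg hI k hk _ => h n gs hrg (fun i hi => ⟨(hI i hi).1, (hI i hi).2.trans hle⟩) k hk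

/-- ★ **THE RUNNING-MAXIMUM ARGUMENT**: top-anchored floors with ONE `M` at EVERY level `γ ≤ γ₀` give the floor on EVERY tail `[k, n)` of every in-`]0, γ₀]` run — read the run at the level of
its own maximum `g_{k₀}` (there it is in-window and touches the top at `k₀`), and compare tails: `Σ_{[k,n)} = g_k⁻² − g_n⁻² ≥ g_{k₀}⁻² − g_n⁻² = Σ_{[k₀,n)} ≥ −M`.
P3 n°101 `runwisePSFloor_of_topRunPSFloor_allLevels`. [cite: Balaban1987RG1, (0.20) p.256; Balaban1988Convergent, (2.6) p.255 (elementary)] -/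
theorem runwisePSFloor_of_topRunPSFloor_allLevels {M γ₀ : ℝ}
    (h : ∀ γ : ℝ, 0 < γ → γ ≤ γ₀ → ∀ (n : ℕ) (gs : ℕ → ℝ), RGEqH n β gs → Step.InInterval γ n gs →
      ∀ k, k ≤ n → gs k = γ → -M ≤ ∑ j ∈ Finset.Ico k n, β j (prefixOf gs j)) :
    ∀ (n : ℕ) (gs : ℕ → ℝ), RGEqH n β gs → Step.InInterval γ₀ n gs → ∀ k, k ≤ n → -M ≤ ∑ j ∈ Finset.Ico k n, β j (prefixOf gs j) := by
  intro n gs hrg hI k hk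
  obtain ⟨k₀, hk₀, hmax⟩ := exists_runMax gs n
  have hγt : 0 < gs k₀ := (hI k₀ hk₀).1
  have hIt : Step.InInterval (gs k₀) n gs := fun i hi => ⟨(hI i hi).1, hmax i hi⟩
  have htop := h (gs k₀) hγt (hI k₀ hk₀).2 n gs hrg hIt k₀ hk₀ rfl
  rw [tail_sum_eq hrg hk₀] at htop
  rw [tail_sum_eq hrg hk]
  have h1 : 1 / (gs k₀) ^ 2 ≤ 1 / (gs k) ^ 2 :=
    one_div_le_one_div_of_le (pow_pos (hI k hk).1 2) (pow_le_pow_left₀ (hI k hk).1.le (hmax k hk) 2)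
  linarith

/-- ★★ **K1⁹'s ROW (iv) AT LEVEL `γ₀` = THE TOP-ANCHORED FORM WITH THE SAME `M`, ASKED AT EVERY LEVEL `≤ γ₀`** — the restriction to top runs is free. P3 n°101 `runwisePSFloor_iff_topRunPSFloor_allLevels`.
[cite: Balaban1987RG1, (0.20) p.256, (5.10) p.293; Balaban1988Convergent, (2.6) p.255 (elementary)] -/
theorem runwisePSFloor_iff_topRunPSFloor_allLevels {M γ₀ : ℝ} :
    (∀ (n : ℕ) (gs : ℕ → ℝ), RGEqH n β gs → Step.InInterval γ₀ n gs → ∀ k, k ≤ n → -M ≤ ∑ j ∈ Finset.Ico k n, β j (prefixOf gs j)) ↔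
      ∀ γ : ℝ, 0 < γ → γ ≤ γ₀ → ∀ (n : ℕ) (gs : ℕ → ℝ), RGEqH n β gs → Step.InInterval γ n gs →
        ∀ k, k ≤ n → gs k = γ → -M ≤ ∑ j ∈ Finset.Ico k n, β j (prefixOf gs j) :=
  ⟨fun h _ _ hle => topRunPSFloor_of_runwisePSFloor h hle, runwisePSFloor_of_topRunPSFloor_allLevels⟩

/-- ★ **CONVERSE ROAD FROM THRESHOLDS**: (T) on `]0, γ₀]` with thresholds `g(γ) > 0` whose floor-equivalents `g(γ)⁻² − γ⁻²` are bounded by ONE `M` ⟹ row (iv) at `γ₀` with that `M`.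
So the ONLY obstruction between the dial's (T) and row (iv) is the LEVEL-UNIFORMITY of the floor. P3 n°101 `runwisePSFloor_of_topRuns_uniform`.
[cite: Balaban1987RG1, (0.20) p.256, Thm 2 p.259 (first sentence); Balaban1988Convergent, (2.6) p.255 (elementary)] -/
theorem runwisePSFloor_of_topRuns_uniform {g : ℝ → ℝ} {M γ₀ : ℝ}
    (hT : ∀ γ : ℝ, 0 < γ → γ ≤ γ₀ → 0 < g γ ∧
      ∀ (n : ℕ) (gs : ℕ → ℝ), RGEqH n β gs → Step.InInterval γ n gs → ∀ k, k ≤ n → gs k = γ → g γ ≤ gs n)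
    (hU : ∀ γ : ℝ, 0 < γ → γ ≤ γ₀ → 1 / (g γ) ^ 2 - 1 / γ ^ 2 ≤ M) :
    ∀ (n : ℕ) (gs : ℕ → ℝ), RGEqH n β gs → Step.InInterval γ₀ n gs → ∀ k, k ≤ n → -M ≤ ∑ j ∈ Finset.Ico k n, β j (prefixOf gs j) :=
  runwisePSFloor_of_topRunPSFloor_allLevels fun γ hγ hle n gs hrg hI k hk hgk =>
    (neg_le_neg (hU γ hγ hle)).trans (topRunPSFloor_of_topRunsAt (hT γ hγ hle).1 (hT γ hγ hle).2 n gs hrg hI k hk hgk)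

/-- ★ **ROWS vs DIAL = ONE QUANTIFIER SWAP over the single proposition «top-anchored floor `M` at level `γ`»**: (a) K1⁹'s row (iv) on some level `γ₀` ⟺ `∃ M, ∀ γ ∈ ]0,γ₀], TopFloor(M, γ)`
(§3); (b) the END-exact dial's (T) on `]0, γ₀]` ⟺ `∀ γ ∈ ]0,γ₀], ∃ M ≥ 0, TopFloor(M, γ)` (FILE 2's `topRunThreshold_iff_topRunPSFloor` BY NAME, level by level).  Of the two named
differences «restricted to top runs» ∕ «de-uniformised in the level» only the second is real; STRICT (FILES 5–6: the sawtooth has (T) everywhere and no uniform floor) and VOID under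
`0 ≤ β` (`M = 0`). P3 n°101's reading, displayed. [cite: Balaban1987RG1, (0.20) p.256, Thm 2 p.259 (first sentence), (5.10) p.293 (bookkeeping)] -/
theorem rows_vs_dial_one_quantifier_swap {γ₀ : ℝ} :
    ((∃ M : ℝ, ∀ (n : ℕ) (gs : ℕ → ℝ), RGEqH n β gs → Step.InInterval γ₀ n gs → ∀ k, k ≤ n → -M ≤ ∑ j ∈ Finset.Ico k n, β j (prefixOf gs j)) ↔
        ∃ M : ℝ, ∀ γ : ℝ, 0 < γ → γ ≤ γ₀ → ∀ (n : ℕ) (gs : ℕ → ℝ), RGEqH n β gs → Step.InInterval γ n gs →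
          ∀ k, k ≤ n → gs k = γ → -M ≤ ∑ j ∈ Finset.Ico k n, β j (prefixOf gs j)) ∧
      ((∀ γ : ℝ, 0 < γ → γ ≤ γ₀ → ∃ gstar : ℝ, 0 < gstar ∧
          ∀ (n : ℕ) (gs : ℕ → ℝ), RGEqH n β gs → Step.InInterval γ n gs → ∀ k, k ≤ n → gs k = γ → gstar ≤ gs n) ↔
        ∀ γ : ℝ, 0 < γ → γ ≤ γ₀ → ∃ M : ℝ, 0 ≤ M ∧ ∀ (n : ℕ) (gs : ℕ → ℝ), RGEqH n β gs → Step.InInterval γ n gs →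
          ∀ k, k ≤ n → gs k = γ → -M ≤ ∑ j ∈ Finset.Ico k n, β j (prefixOf gs j)) :=
  ⟨⟨fun ⟨M, h⟩ => ⟨M, runwisePSFloor_iff_topRunPSFloor_allLevels.1 h⟩, fun ⟨M, h⟩ => ⟨M, runwisePSFloor_iff_topRunPSFloor_allLevels.2 h⟩⟩,
    ⟨fun h γ hγ hle => (topRunThreshold_iff_topRunPSFloor β hγ).1 (h γ hγ hle), fun h γ hγ hle => (topRunThreshold_iff_topRunPSFloor β hγ).2 (h γ hγ hle)⟩⟩

/-! ## §4 By name at the record's `β_θ` (CONDITIONAL on K1⁹'s OPEN rows conjunct) -/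

/-- **AT A ROWS WITNESS THE TOP-ANCHORED TAILS OF `β_θ` ARE FLOORED BY ONE CONSTANT AT EVERY LEVEL `≤ γ₀`**: K1⁹'s rows `K1R8RowsDefs.RunRowsCont13 F θ` (stmt-QuantumFields-27364's last
conjunct, `Iff.rfl`) give `M, γ₀ > 0` with the top-anchored floor `−M` at every level `γ ≤ γ₀` for `β_θ := Node00.betaOfRecord₁₃ F 2 θ.toStage13Params` — the level-uniform form of the dial's
(T) letter (§3, trivial direction).  CONDITIONAL on the OPEN conjunct; nothing about `betaOfRecord₁₃` is inhabited here. [cite: Balaban1987RG1, Thm 3 p.264, (5.10) p.293, (0.20) p.256 (bookkeeping)] -/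
theorem topFloors_uniform_of_runRowsCont13 {F : T4Family} {θ : Node00.Stage13HParams F 2} (h : RunRowsCont13 F θ) :
    ∃ M γ₀ : ℝ, 0 < γ₀ ∧ ∀ γ : ℝ, 0 < γ → γ ≤ γ₀ → ∀ (n : ℕ) (gs : ℕ → ℝ),
      RGEqH n (Node00.betaOfRecord₁₃ F 2 θ.toStage13Params) gs → Step.InInterval γ n gs →
        ∀ k, k ≤ n → gs k = γ → -M ≤ ∑ j ∈ Finset.Ico k n, Node00.betaOfRecord₁₃ F 2 θ.toStage13Params j (prefixOf gs j) := by
  obtain ⟨_, _, γ₀, M, hγ₀, -, hps, -⟩ := h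
  exact ⟨M, γ₀, hγ₀, fun γ _ hle => topRunPSFloor_of_runwisePSFloor hps hle⟩

end Summit.QuantumFields.YangMills.Theorems.BalabanUVNodesK1EndExactTopRunsFree

end
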